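import Literature.Barriers.CriticalPhenomena.LaceExpansionConvolutionBounds
import Mathlib.Analysis.SumIntegralComparisons
import Mathlib.Analysis.SpecialFunctions.Integrals.Basic
import HarnessLib

/-!
# Lattice sums for Hara's Gaussian lemma: ball and tail sums of `⟦x⟧^{-s}`, region splitting

Support file for the decomposition of the named fact `Hara2008_gaussianConvolution`
(`LaceExpansionXSpaceAsymptotics.lean`; Hara 2008, Cor. 1.4). The proof of Hara's Lemma B.1 —
the convolution estimates of Hara–van der Hofstad–Slade 2003, Prop. 1.7, on which Cor. 1.4 and
Lemma 2.3 of Hara 2008 rest — needs the elementary lattice sums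
`Σ_{|y| ≤ R} ⟦y⟧^{-a} ≤ C (R ∨ 1)^{d-a}` (`0 ≤ a < d`) and `Σ_{|y| > R} ⟦y⟧^{-s} ≤ C (R ∨ 1)^{d-s}`
(`s > d`), with `⟦y⟧ = |y| ∨ 1` the regularised Euclidean norm of the catalogue (`jnorm`). They are
PROVED here (all `d ≥ 1`, real exponents, sharp in `R`) by the cubic-shell decomposition of
`LaceExpansionHighDimensionProofs.lean` (`|∂Λ_{k+1}| ≤ 2d 3^{d-1} (k+1)^{d-1}`) and comparison of the
one-dimensional sums `Σ (k+1)^e` with `∫ u^e du` (`AntitoneOn.sum_le_integral_Ico`). The companion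
file `LaceExpansionConvolutionBounds.lean` (imported; `supNorm_le_jnorm`, `tsum_comp_sub_left`) has
the ball sum for `s ≤ d - 1` only and no tail sum; the full range `0 ≤ a < d` and the sharp tail
`Σ_{|y|>R}⟦y⟧^{-s} ≤ C R^{d-s}` are what Hara's Lemma B.1 (ii) in its printed form (one exponent
`0 < ρ < 2`) and Lemma B.1 (iii) (the input of Lemma 2.3) consume.

## Contents (all PROVED, `[folklore]`)

* one-dimensional power sums `sum_Ico_succ_rpow_le_of_lt`, `sum_range_succ_rpow_le_of_le`,
  `sum_range_succ_rpow_le_of_nonneg`;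
* cubic shell sums with real exponents: `exists_sum_box_sdiff_jnorm_rpow_neg_le` (tails over
  `Λ_N ∖ Λ_M`, uniformly in `N`), `exists_sum_box_jnorm_rpow_neg_le` (balls `Λ_N`);
* Euclidean balls and tails as `tsum`s of indicator functions:
  `exists_tsum_ball_jnorm_rpow_neg_le`, `exists_tsum_tail_jnorm_rpow_neg_le`
  (constants depending on `d` and the exponent only);
* the geometry of `⟦·⟧`: `jnorm_le_mul_jnorm` (`|x| ≤ c|y| ⇒ ⟦x⟧ ≤ c⟦y⟧`),
  `jnorm_rpow_neg_le_of_jnorm_le`, `max_div_one_rpow_le`, the parallelogram law and triangle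
  inequalities for `euclidNorm`;
* region splitting of lattice sums (`tsum_eq_tsum_indicator_add_compl`, `abs_tsum_indicator_le`).

## References

* T. Hara, *Decay of correlations in nearest-neighbor self-avoiding walk, percolation, lattice
  trees and animals*, Ann. Probab. 36 (2008) 530–593, Appendix B (Lemma B.1 and its proof:
  "`Σ_{y:|y|<|x|/2} ⟦y⟧^{-α} ≤ C'|x|^{d-α}`", "`Σ_{|y| ≥ ε|x|} |g(y)| → 0`").
* T. Hara, R. van der Hofstad, G. Slade, *Critical two-point functions and the lace expansion for
  spread-out high-dimensional percolation and related models*, Ann. Probab. 31 (2003) 349–408,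
  Prop. 1.7 and §5.
-/

noncomputable section

namespace Literature.Barriers.CriticalPhenomena

open MeasureTheory Finset Literature.Probability.LatticeModels

variable {d : ℕ}

/-! ### One-dimensional power sums -/

/-- `Σ_{M ≤ k < N} (k+1)^e ≤ M^{e+1}/(-(e+1))` for `e < -1`, `M ≥ 1` (comparison with
`∫_M^N u^e du`). [folklore] -/
theorem sum_Ico_succ_rpow_le_of_lt {e : ℝ} (he : e < -1) {M N : ℕ} (hM : 1 ≤ M) :
    ∑ k ∈ Finset.Ico M N, ((k : ℝ) + 1) ^ e ≤ (M : ℝ) ^ (e + 1) / (-(e + 1)) := by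
  have hM0 : (0 : ℝ) < M := by exact_mod_cast hM
  have he1 : e + 1 < 0 := by linarith
  rcases le_or_gt N M with hNM | hMN
  · rw [Finset.Ico_eq_empty_of_le hNM, Finset.sum_empty]
    exact div_nonneg (Real.rpow_nonneg hM0.le _) (by linarith)
  have hanti : AntitoneOn (fun u : ℝ => u ^ e) (Set.Icc (M : ℝ) N) := by
    intro u hu v hv huv
    exact Real.rpow_le_rpow_of_nonpos (hM0.trans_le hu.1) huv (by linarith)
  have h1 := AntitoneOn.sum_le_integral_Ico hMN.le hanti
  have h2 : ∫ u in (M : ℝ)..N, u ^ e = ((N : ℝ) ^ (e + 1) - (M : ℝ) ^ (e + 1)) / (e + 1) := by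
    apply integral_rpow
    right
    refine ⟨by linarith, ?_⟩
    rw [Set.uIcc_of_le (by exact_mod_cast hMN.le)]
    intro h0
    exact absurd h0.1 (not_le.2 hM0)
  have h3 : ((N : ℝ) ^ (e + 1) - (M : ℝ) ^ (e + 1)) / (e + 1) ≤ (M : ℝ) ^ (e + 1) / (-(e + 1)) := by
    rw [← neg_sub, neg_div, ← div_neg]
    have hN : 0 ≤ (N : ℝ) ^ (e + 1) := Real.rpow_nonneg (Nat.cast_nonneg N) _
    exact div_le_div_of_nonneg_right (by linarith) (by linarith)
  calc ∑ k ∈ Finset.Ico M N, ((k : ℝ) + 1) ^ e = ∑ k ∈ Finset.Ico M N, (((k + 1 : ℕ) : ℝ)) ^ e := by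
        push_cast; rfl
    _ ≤ ∫ u in (M : ℝ)..N, u ^ e := h1
    _ = _ := h2
    _ ≤ _ := h3

/-- `Σ_{k < N} (k+1)^e ≤ 1 + N^{e+1}/(e+1)` for `-1 < e ≤ 0`, `N ≥ 1` (comparison with
`∫_1^N u^e du`). [folklore] -/
theorem sum_range_succ_rpow_le_of_le {e : ℝ} (he : -1 < e) (he0 : e ≤ 0) {N : ℕ} (hN : 1 ≤ N) :
    ∑ k ∈ Finset.range N, ((k : ℝ) + 1) ^ e ≤ 1 + (N : ℝ) ^ (e + 1) / (e + 1) := by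
  have he1 : 0 < e + 1 := by linarith
  have hN0 : (0 : ℝ) < N := by exact_mod_cast hN
  rw [Finset.range_eq_Ico, ← Finset.sum_Ico_consecutive _ (Nat.zero_le 1) hN, Finset.sum_Ico_succ_top (Nat.zero_le 0),
    Finset.Ico_self, Finset.sum_empty]
  simp only [CharP.cast_eq_zero, zero_add, Real.one_rpow]
  gcongr
  have hanti : AntitoneOn (fun u : ℝ => u ^ e) (Set.Icc ((1 : ℕ) : ℝ) N) := by
    intro u hu v hv huv
    have hu1 : (0 : ℝ) < u := by have := hu.1; push_cast at this; linarith
    exact Real.rpow_le_rpow_of_nonpos hu1 huv he0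
  have h1 := AntitoneOn.sum_le_integral_Ico hN hanti
  have h2 : ∫ u in ((1 : ℕ) : ℝ)..N, u ^ e = ((N : ℝ) ^ (e + 1) - 1) / (e + 1) := by
    rw [integral_rpow (Or.inl he)]
    push_cast
    rw [Real.one_rpow]
  calc ∑ k ∈ Finset.Ico 1 N, ((k : ℝ) + 1) ^ e = ∑ k ∈ Finset.Ico 1 N, (((k + 1 : ℕ) : ℝ)) ^ e := by
        push_cast; rfl
    _ ≤ _ := h1
    _ = _ := h2
    _ ≤ (N : ℝ) ^ (e + 1) / (e + 1) := by
        gcongr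
        linarith

/-- `Σ_{k < N} (k+1)^e ≤ N · N^e` for `e ≥ 0`. [folklore] -/
theorem sum_range_succ_rpow_le_of_nonneg {e : ℝ} (he : 0 ≤ e) (N : ℕ) :
    ∑ k ∈ Finset.range N, ((k : ℝ) + 1) ^ e ≤ N * (N : ℝ) ^ e := by
  calc ∑ k ∈ Finset.range N, ((k : ℝ) + 1) ^ e ≤ ∑ _k ∈ Finset.range N, (N : ℝ) ^ e :=
        Finset.sum_le_sum fun k hk => by
          have hkN : (k : ℝ) + 1 ≤ N := by exact_mod_cast Finset.mem_range.1 hk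
          exact Real.rpow_le_rpow (by positivity) hkN he
    _ = N * (N : ℝ) ^ e := by rw [Finset.sum_const, Finset.card_range, nsmul_eq_mul]


/-! ### Sup norm versus `⟦·⟧` -/

/-- `max(1, ‖z‖_∞) ≤ ⟦z⟧`. [folklore] -/
theorem max_one_supNorm_le_jnorm (z : Site d) : ((max 1 (Site.supNorm z) : ℕ) : ℝ) ≤ jnorm z := by
  rw [Nat.cast_max, Nat.cast_one, max_le_iff]
  exact ⟨one_le_jnorm z, supNorm_le_jnorm z⟩

/-- `⟦z⟧^{-s} ≤ max(1,‖z‖_∞)^{-s}` for `s ≥ 0`. [folklore] -/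
theorem jnorm_rpow_neg_le_max_supNorm (z : Site d) {s : ℝ} (hs : 0 ≤ s) :
    jnorm z ^ (-s) ≤ ((max 1 (Site.supNorm z) : ℕ) : ℝ) ^ (-s) :=
  Real.rpow_le_rpow_of_nonpos (by positivity) (max_one_supNorm_le_jnorm z) (by linarith)

/-- `|z| ≤ √d ‖z‖_∞`, with the sup norm as a natural number. [folklore] -/
theorem euclidNorm_le_sqrt_mul_supNorm (z : Site d) : euclidNorm z ≤ √(d : ℝ) * Site.supNorm z := by
  rw [← Site.norm_eq_supNorm]
  exact euclidNorm_le_sqrt_mul_norm z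

/-! ### Lattice shell sums with real exponents -/

/-- **Tail sum over a cubic annulus**: `Σ_{z ∈ Λ_N ∖ Λ_M} ⟦z⟧^{-s} ≤ C (M+1)^{d-s}` for
`s > d ≥ 1`, uniformly in `N` (shells `|∂Λ_{k+1}| ≤ 2d 3^{d-1} (k+1)^{d-1}` and
`Σ_{k ≥ M} (k+1)^{d-1-s} ≤ ∫`). [folklore] -/
theorem exists_sum_box_sdiff_jnorm_rpow_neg_le (hd : 1 ≤ d) {s : ℝ} (hs : (d : ℝ) < s) :
    ∃ C : ℝ, 0 ≤ C ∧ ∀ M N : ℕ,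
      ∑ z ∈ box d N \ box d M, jnorm z ^ (-s) ≤ C * ((M : ℝ) + 1) ^ ((d : ℝ) - s) := by
  have hsd : 0 < s - d := by linarith
  refine ⟨2 * d * 3 ^ (d - 1) * ((2 : ℝ) ^ (s - d) / (s - d) + 1), by positivity, fun M N => ?_⟩
  have hM1 : (0 : ℝ) < (M : ℝ) + 1 := by positivity
  rcases le_or_gt N M with hNM | hMN
  · rw [Finset.sdiff_eq_empty_iff_subset.2 (box_mono d hNM), Finset.sum_empty]
    exact mul_nonneg (by positivity) (Real.rpow_nonneg hM1.le _)
  -- compare with the function of the sup norm and decompose into shells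
  have hle : ∑ z ∈ box d N \ box d M, jnorm z ^ (-s) ≤
      ∑ z ∈ box d N \ box d M, (fun k : ℕ => (((max 1 k : ℕ) : ℝ)) ^ (-s)) (Site.supNorm z) :=
    Finset.sum_le_sum fun z _ => jnorm_rpow_neg_le_max_supNorm z (by linarith)
  have hdec := sum_box_sdiff_box_eq_sum_Ico (d := d) (fun k : ℕ => (((max 1 k : ℕ) : ℝ)) ^ (-s)) hMN.le
  rw [hdec] at hle
  -- one shell
  have hshell : ∀ k ∈ Finset.Ico M N, (#(sphere d (k + 1)) : ℝ) * ((((max 1 (k + 1) : ℕ) : ℝ)) ^ (-s)) ≤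
      2 * d * 3 ^ (d - 1) * ((k : ℝ) + 1) ^ ((d : ℝ) - 1 - s) := by
    intro k _
    have hk1 : (0 : ℝ) < (k : ℝ) + 1 := by positivity
    rw [show max 1 (k + 1) = k + 1 from max_eq_right (by omega)]
    push_cast
    have hcard := card_sphere_succ_le' (d := d) hd k
    have hpow : ((k : ℝ) + 1) ^ (d - 1) * ((k : ℝ) + 1) ^ (-s) = ((k : ℝ) + 1) ^ ((d : ℝ) - 1 - s) := by
      rw [← Real.rpow_natCast, ← Real.rpow_add hk1, Nat.cast_sub hd, Nat.cast_one]
      ring_nf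
    calc (#(sphere d (k + 1)) : ℝ) * ((k : ℝ) + 1) ^ (-s)
        ≤ 2 * d * 3 ^ (d - 1) * ((k : ℝ) + 1) ^ (d - 1) * ((k : ℝ) + 1) ^ (-s) := by
          gcongr
      _ = 2 * d * 3 ^ (d - 1) * ((k : ℝ) + 1) ^ ((d : ℝ) - 1 - s) := by rw [mul_assoc, hpow]
  -- the one-dimensional tail
  have htail : ∑ k ∈ Finset.Ico M N, ((k : ℝ) + 1) ^ ((d : ℝ) - 1 - s) ≤
      ((2 : ℝ) ^ (s - d) / (s - d) + 1) * ((M : ℝ) + 1) ^ ((d : ℝ) - s) := by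
    have he : (d : ℝ) - 1 - s < -1 := by linarith
    rcases Nat.eq_zero_or_pos M with hM0 | hMpos
    · subst hM0
      simp only [CharP.cast_eq_zero, zero_add, Real.one_rpow, mul_one]
      rw [← Finset.sum_Ico_consecutive _ (Nat.zero_le 1) (by omega : 1 ≤ N), Finset.sum_Ico_succ_top (Nat.zero_le 0),
        Finset.Ico_self, Finset.sum_empty]
      simp only [CharP.cast_eq_zero, zero_add, Real.one_rpow]
      have h1 := sum_Ico_succ_rpow_le_of_lt he (M := 1) (N := N) le_rfl
      simp only [Nat.cast_one, Real.one_rpow] at h1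
      have h2 : (1 : ℝ) / (-((d : ℝ) - 1 - s + 1)) = 1 / (s - d) := by congr 1; ring
      rw [h2] at h1
      have h3 : 1 / (s - d) ≤ (2 : ℝ) ^ (s - d) / (s - d) :=
        div_le_div_of_nonneg_right (Real.one_le_rpow (by norm_num) hsd.le) hsd.le
      linarith
    · have h1 := sum_Ico_succ_rpow_le_of_lt he (N := N) hMpos
      have hM0 : (0 : ℝ) < M := by exact_mod_cast hMpos
      have h2 : (M : ℝ) ^ ((d : ℝ) - 1 - s + 1) / (-((d : ℝ) - 1 - s + 1)) = (M : ℝ) ^ ((d : ℝ) - s) / (s - d) := by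
        congr 1 <;> ring_nf
      rw [h2] at h1
      have h3 : (M : ℝ) ^ ((d : ℝ) - s) ≤ (2 : ℝ) ^ (s - d) * ((M : ℝ) + 1) ^ ((d : ℝ) - s) := by
        have hhalf : ((M : ℝ) + 1) / 2 ≤ M := by linarith [show (1 : ℝ) ≤ M by exact_mod_cast hMpos]
        calc (M : ℝ) ^ ((d : ℝ) - s) ≤ (((M : ℝ) + 1) / 2) ^ ((d : ℝ) - s) :=
              Real.rpow_le_rpow_of_nonpos (by positivity) hhalf (by linarith)
          _ = (2 : ℝ) ^ (s - d) * ((M : ℝ) + 1) ^ ((d : ℝ) - s) := by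
              rw [Real.div_rpow hM1.le (by norm_num), div_eq_mul_inv, ← Real.rpow_neg (by norm_num), neg_sub, mul_comm]
      calc ∑ k ∈ Finset.Ico M N, ((k : ℝ) + 1) ^ ((d : ℝ) - 1 - s) ≤ (M : ℝ) ^ ((d : ℝ) - s) / (s - d) := h1
        _ ≤ (2 : ℝ) ^ (s - d) * ((M : ℝ) + 1) ^ ((d : ℝ) - s) / (s - d) := div_le_div_of_nonneg_right h3 hsd.le
        _ = ((2 : ℝ) ^ (s - d) / (s - d)) * ((M : ℝ) + 1) ^ ((d : ℝ) - s) := by ring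
        _ ≤ ((2 : ℝ) ^ (s - d) / (s - d) + 1) * ((M : ℝ) + 1) ^ ((d : ℝ) - s) := by
            have : 0 ≤ ((M : ℝ) + 1) ^ ((d : ℝ) - s) := Real.rpow_nonneg hM1.le _
            nlinarith
  calc ∑ z ∈ box d N \ box d M, jnorm z ^ (-s)
      ≤ ∑ k ∈ Finset.Ico M N, (#(sphere d (k + 1)) : ℝ) * ((((max 1 (k + 1) : ℕ) : ℝ)) ^ (-s)) := hle
    _ ≤ ∑ k ∈ Finset.Ico M N, 2 * d * 3 ^ (d - 1) * ((k : ℝ) + 1) ^ ((d : ℝ) - 1 - s) := Finset.sum_le_sum hshell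
    _ = 2 * d * 3 ^ (d - 1) * ∑ k ∈ Finset.Ico M N, ((k : ℝ) + 1) ^ ((d : ℝ) - 1 - s) := by rw [Finset.mul_sum]
    _ ≤ 2 * d * 3 ^ (d - 1) * (((2 : ℝ) ^ (s - d) / (s - d) + 1) * ((M : ℝ) + 1) ^ ((d : ℝ) - s)) := by
        gcongr
    _ = _ := by ring


/-- **Ball sum**: `Σ_{z ∈ Λ_N} ⟦z⟧^{-a} ≤ C (N+1)^{d-a}` for `0 ≤ a < d`, `d ≥ 1`.
[folklore] -/
theorem exists_sum_box_jnorm_rpow_neg_le (hd : 1 ≤ d) {a : ℝ} (ha0 : 0 ≤ a) (ha : a < d) :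
    ∃ C : ℝ, 0 ≤ C ∧ ∀ N : ℕ, ∑ z ∈ box d N, jnorm z ^ (-a) ≤ C * ((N : ℝ) + 1) ^ ((d : ℝ) - a) := by
  classical
  have hda : 0 < (d : ℝ) - a := by linarith
  refine ⟨1 + 2 * d * 3 ^ (d - 1) * (1 + 1 / (d - a)), by positivity, fun N => ?_⟩
  have hN1 : (0 : ℝ) < (N : ℝ) + 1 := by positivity
  have hN1' : (1 : ℝ) ≤ (N : ℝ) + 1 := by linarith [(Nat.cast_nonneg N : (0 : ℝ) ≤ N)]
  have hsplit : ∑ z ∈ box d N, jnorm z ^ (-a) = jnorm (0 : Site d) ^ (-a) + ∑ z ∈ (box d N).erase 0, jnorm z ^ (-a) :=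
    (Finset.add_sum_erase _ _ (zero_mem_box d N)).symm
  rw [hsplit, jnorm_zero, Real.one_rpow]
  have hle : ∑ z ∈ (box d N).erase 0, jnorm z ^ (-a) ≤
      ∑ z ∈ (box d N).erase 0, (fun k : ℕ => (((max 1 k : ℕ) : ℝ)) ^ (-a)) (Site.supNorm z) :=
    Finset.sum_le_sum fun z _ => jnorm_rpow_neg_le_max_supNorm z ha0
  have hdec := sum_box_erase_zero_eq_sum_range (d := d) (fun k : ℕ => (((max 1 k : ℕ) : ℝ)) ^ (-a)) N
  rw [hdec] at hle
  have hshell : ∀ k ∈ Finset.range N, (#(sphere d (k + 1)) : ℝ) * ((((max 1 (k + 1) : ℕ) : ℝ)) ^ (-a)) ≤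
      2 * d * 3 ^ (d - 1) * ((k : ℝ) + 1) ^ ((d : ℝ) - 1 - a) := by
    intro k _
    have hk1 : (0 : ℝ) < (k : ℝ) + 1 := by positivity
    rw [show max 1 (k + 1) = k + 1 from max_eq_right (by omega)]
    push_cast
    have hcard := card_sphere_succ_le' (d := d) hd k
    have hpow : ((k : ℝ) + 1) ^ (d - 1) * ((k : ℝ) + 1) ^ (-a) = ((k : ℝ) + 1) ^ ((d : ℝ) - 1 - a) := by
      rw [← Real.rpow_natCast, ← Real.rpow_add hk1, Nat.cast_sub hd, Nat.cast_one]
      ring_nf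
    calc (#(sphere d (k + 1)) : ℝ) * ((k : ℝ) + 1) ^ (-a)
        ≤ 2 * d * 3 ^ (d - 1) * ((k : ℝ) + 1) ^ (d - 1) * ((k : ℝ) + 1) ^ (-a) := by gcongr
      _ = 2 * d * 3 ^ (d - 1) * ((k : ℝ) + 1) ^ ((d : ℝ) - 1 - a) := by rw [mul_assoc, hpow]
  -- the one-dimensional sum `Σ_{k<N} (k+1)^{d-1-a} ≤ (1 + 1/(d-a)) (N+1)^{d-a}`
  have hsum : ∑ k ∈ Finset.range N, ((k : ℝ) + 1) ^ ((d : ℝ) - 1 - a) ≤ (1 + 1 / (d - a)) * ((N : ℝ) + 1) ^ ((d : ℝ) - a) := by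
    have hX : 0 ≤ ((N : ℝ) + 1) ^ ((d : ℝ) - a) := Real.rpow_nonneg hN1.le _
    have hX1 : 1 ≤ ((N : ℝ) + 1) ^ ((d : ℝ) - a) := Real.one_le_rpow hN1' hda.le
    rcases le_or_gt 0 ((d : ℝ) - 1 - a) with he | he
    · -- increasing summands
      have h1 := sum_range_succ_rpow_le_of_nonneg he N
      have h2 : (N : ℝ) * (N : ℝ) ^ ((d : ℝ) - 1 - a) ≤ ((N : ℝ) + 1) ^ ((d : ℝ) - a) := by
        calc (N : ℝ) * (N : ℝ) ^ ((d : ℝ) - 1 - a) ≤ ((N : ℝ) + 1) * ((N : ℝ) + 1) ^ ((d : ℝ) - 1 - a) := by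
              gcongr <;> linarith
          _ = ((N : ℝ) + 1) ^ ((d : ℝ) - a) := by
              rw [← Real.rpow_one_add' hN1.le (by linarith)]
              ring_nf
      calc _ ≤ _ := h1
        _ ≤ ((N : ℝ) + 1) ^ ((d : ℝ) - a) := h2
        _ ≤ (1 + 1 / (d - a)) * ((N : ℝ) + 1) ^ ((d : ℝ) - a) := by
            have : 0 ≤ 1 / ((d : ℝ) - a) := by positivity
            nlinarith
    · -- decreasing summands
      rcases Nat.eq_zero_or_pos N with hN0 | hNpos
      · subst hN0
        simp only [Finset.range_zero, Finset.sum_empty]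
        positivity
      have hN0 : (0 : ℝ) < N := by exact_mod_cast hNpos
      have h1 := sum_range_succ_rpow_le_of_le (by linarith) he.le hNpos
      have h2 : (N : ℝ) ^ ((d : ℝ) - 1 - a + 1) / ((d : ℝ) - 1 - a + 1) = (N : ℝ) ^ ((d : ℝ) - a) / ((d : ℝ) - a) := by
        congr 1 <;> ring_nf
      rw [h2] at h1
      have h3 : (N : ℝ) ^ ((d : ℝ) - a) ≤ ((N : ℝ) + 1) ^ ((d : ℝ) - a) :=
        Real.rpow_le_rpow hN0.le (by linarith) hda.le
      calc _ ≤ 1 + (N : ℝ) ^ ((d : ℝ) - a) / ((d : ℝ) - a) := h1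
        _ ≤ ((N : ℝ) + 1) ^ ((d : ℝ) - a) + ((N : ℝ) + 1) ^ ((d : ℝ) - a) / ((d : ℝ) - a) := by
            gcongr
        _ = (1 + 1 / (d - a)) * ((N : ℝ) + 1) ^ ((d : ℝ) - a) := by ring
  calc 1 + ∑ z ∈ (box d N).erase 0, jnorm z ^ (-a)
      ≤ 1 + ∑ k ∈ Finset.range N, (#(sphere d (k + 1)) : ℝ) * ((((max 1 (k + 1) : ℕ) : ℝ)) ^ (-a)) := by linarith
    _ ≤ 1 + ∑ k ∈ Finset.range N, 2 * d * 3 ^ (d - 1) * ((k : ℝ) + 1) ^ ((d : ℝ) - 1 - a) :=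
        add_le_add le_rfl (Finset.sum_le_sum hshell)
    _ = 1 + 2 * d * 3 ^ (d - 1) * ∑ k ∈ Finset.range N, ((k : ℝ) + 1) ^ ((d : ℝ) - 1 - a) := by rw [Finset.mul_sum]
    _ ≤ 1 * ((N : ℝ) + 1) ^ ((d : ℝ) - a) + 2 * d * 3 ^ (d - 1) * ((1 + 1 / (d - a)) * ((N : ℝ) + 1) ^ ((d : ℝ) - a)) := by
        gcongr
        rw [one_mul]
        exact Real.one_le_rpow hN1' hda.le
    _ = _ := by ring


/-! ### Euclidean balls and tails as lattice sums -/

/-- `‖y‖_∞ ≤ |y|`, with the sup norm as a natural number. [folklore] -/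
theorem supNorm_le_euclidNorm (y : Site d) : (Site.supNorm y : ℝ) ≤ euclidNorm y := by
  rw [← Site.norm_eq_supNorm]; exact norm_le_euclidNorm y

/-- A point of the Euclidean ball `|y| ≤ R` lies in the cube `Λ_{⌊R⌋}`. [folklore] -/
theorem mem_box_floor_of_euclidNorm_le {y : Site d} {R : ℝ} (h : euclidNorm y ≤ R) : y ∈ box d ⌊R⌋₊ := by
  rw [mem_box_iff_supNorm_le]
  exact Nat.le_floor ((supNorm_le_euclidNorm y).trans h)

/-- A point outside the Euclidean ball `|y| ≤ R` lies outside the cube `Λ_{⌊R/√d⌋}` (`d ≥ 1`).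
[folklore] -/
theorem not_mem_box_of_lt_euclidNorm (hd : 1 ≤ d) {y : Site d} {R : ℝ} (hR : 0 ≤ R) (h : R < euclidNorm y) :
    y ∉ box d ⌊R / √(d : ℝ)⌋₊ := by
  intro hy
  rw [mem_box_iff_supNorm_le] at hy
  have hd0 : (0 : ℝ) < √(d : ℝ) := Real.sqrt_pos.2 (by exact_mod_cast hd)
  have h1 : (Site.supNorm y : ℝ) ≤ R / √(d : ℝ) := by
    calc (Site.supNorm y : ℝ) ≤ (⌊R / √(d : ℝ)⌋₊ : ℝ) := by exact_mod_cast hy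
      _ ≤ R / √(d : ℝ) := Nat.floor_le (div_nonneg hR hd0.le)
  have h2 := euclidNorm_le_sqrt_mul_supNorm y
  have h3 : √(d : ℝ) * (Site.supNorm y : ℝ) ≤ R := by
    rw [le_div_iff₀ hd0] at h1; linarith
  linarith

/-- Functions supported in a Euclidean ball are finitely supported, hence summable. [folklore] -/
theorem summable_indicator_ball (R : ℝ) (F : Site d → ℝ) :
    Summable ({y : Site d | euclidNorm y ≤ R}.indicator F) := by
  refine summable_of_ne_finset_zero (s := box d ⌊R⌋₊) fun y hy => ?_
  rw [Set.indicator_of_notMem]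
  exact fun h => hy (mem_box_floor_of_euclidNorm_le h)

/-- The lattice sum of a function supported in the ball `|y| ≤ R` is a finite sum over the cube
`Λ_{⌊R⌋}`. [folklore] -/
theorem tsum_indicator_ball_eq_sum (R : ℝ) (F : Site d → ℝ) :
    ∑' y, {y : Site d | euclidNorm y ≤ R}.indicator F y =
      ∑ y ∈ box d ⌊R⌋₊, {y : Site d | euclidNorm y ≤ R}.indicator F y :=
  tsum_eq_sum fun y hy => by
    rw [Set.indicator_of_notMem]
    exact fun h => hy (mem_box_floor_of_euclidNorm_le h)

/-- **Euclidean ball sum**: `Σ_{|y| ≤ R} ⟦y⟧^{-a} ≤ C (R ∨ 1)^{d-a}` for `0 ≤ a < d`,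
`d ≥ 1`, every real `R`. [folklore] -/
theorem exists_tsum_ball_jnorm_rpow_neg_le (hd : 1 ≤ d) {a : ℝ} (ha0 : 0 ≤ a) (ha : a < d) :
    ∃ C : ℝ, 0 ≤ C ∧ ∀ R : ℝ, ∑' y, {y : Site d | euclidNorm y ≤ R}.indicator (fun y => jnorm y ^ (-a)) y ≤
      C * (max R 1) ^ ((d : ℝ) - a) := by
  have hda : 0 ≤ (d : ℝ) - a := by linarith
  obtain ⟨C₀, hC₀, hbox⟩ := exists_sum_box_jnorm_rpow_neg_le hd ha0 ha
  refine ⟨C₀ * 2 ^ ((d : ℝ) - a), by positivity, fun R => ?_⟩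
  have hRm : (1 : ℝ) ≤ max R 1 := le_max_right _ _
  rw [tsum_indicator_ball_eq_sum]
  rcases lt_or_ge R 0 with hR | hR
  · have h0 : ∀ y ∈ box d ⌊R⌋₊, {y : Site d | euclidNorm y ≤ R}.indicator (fun y => jnorm y ^ (-a)) y = 0 := by
      intro y _
      rw [Set.indicator_of_notMem]
      intro (h : euclidNorm y ≤ R)
      linarith [euclidNorm_nonneg y]
    rw [Finset.sum_congr rfl h0, Finset.sum_const_zero]
    exact mul_nonneg (by positivity) (Real.rpow_nonneg (by linarith) _)
  calc ∑ y ∈ box d ⌊R⌋₊, {y : Site d | euclidNorm y ≤ R}.indicator (fun y => jnorm y ^ (-a)) y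
      ≤ ∑ y ∈ box d ⌊R⌋₊, jnorm y ^ (-a) :=
        Finset.sum_le_sum fun y _ => Set.indicator_le_self' (fun _ _ => Real.rpow_nonneg (jnorm_pos y).le _) y
    _ ≤ C₀ * ((⌊R⌋₊ : ℝ) + 1) ^ ((d : ℝ) - a) := hbox _
    _ ≤ C₀ * (2 * max R 1) ^ ((d : ℝ) - a) := by
        gcongr
        linarith [Nat.floor_le hR, le_max_left R 1]
    _ = C₀ * 2 ^ ((d : ℝ) - a) * (max R 1) ^ ((d : ℝ) - a) := by
        rw [Real.mul_rpow (by norm_num) (by linarith)]; ring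

/-- Tail-supported powers `⟦y⟧^{-s} 1{|y| > R}` are summable for `s > d`. [folklore] -/
theorem summable_indicator_compl_ball {s : ℝ} (hs : (d : ℝ) < s) (R : ℝ) :
    Summable ({y : Site d | euclidNorm y ≤ R}ᶜ.indicator fun y => jnorm y ^ (-s)) :=
  (summable_jnorm_rpow_neg hs).indicator _

/-- **Euclidean tail sum**: `Σ_{|y| > R} ⟦y⟧^{-s} ≤ C (R ∨ 1)^{d-s}` for `s > d ≥ 1`,
every real `R`. [folklore] -/
theorem exists_tsum_tail_jnorm_rpow_neg_le (hd : 1 ≤ d) {s : ℝ} (hs : (d : ℝ) < s) :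
    ∃ C : ℝ, 0 ≤ C ∧ ∀ R : ℝ, ∑' y, {y : Site d | euclidNorm y ≤ R}ᶜ.indicator (fun y => jnorm y ^ (-s)) y ≤
      C * (max R 1) ^ ((d : ℝ) - s) := by
  classical
  have hsd : 0 < s - d := by linarith
  have hd0 : (0 : ℝ) < d := by exact_mod_cast hd
  obtain ⟨C₀, htc, htail⟩ := exists_sum_box_sdiff_jnorm_rpow_neg_le hd hs
  refine ⟨(1 + C₀) * (d : ℝ) ^ ((s - d) / 2), by positivity, fun R => ?_⟩
  have hRm : (1 : ℝ) ≤ max R 1 := le_max_right _ _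
  refine Real.tsum_le_of_sum_le (fun y => Set.indicator_nonneg (fun _ _ => Real.rpow_nonneg (jnorm_pos _).le _) y)
    fun u => ?_
  set N := u.sup Site.supNorm with hN
  have huN : u ⊆ box d N := fun y hy => mem_box_iff_supNorm_le.2 (Finset.le_sup (f := Site.supNorm) hy)
  rcases lt_or_ge R 1 with hR1 | hR1
  · -- small radius: bound by the full sum `1 + Σ_{Λ_N ∖ Λ_0}`
    rw [max_eq_right hR1.le, Real.one_rpow, mul_one]
    calc ∑ y ∈ u, {y : Site d | euclidNorm y ≤ R}ᶜ.indicator (fun y => jnorm y ^ (-s)) y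
        ≤ ∑ y ∈ u, jnorm y ^ (-s) :=
          Finset.sum_le_sum fun y _ => Set.indicator_le_self' (fun _ _ => Real.rpow_nonneg (jnorm_pos y).le _) y
      _ ≤ ∑ y ∈ box d N, jnorm y ^ (-s) :=
          Finset.sum_le_sum_of_subset_of_nonneg huN fun y _ _ => Real.rpow_nonneg (jnorm_pos y).le _
      _ = 1 + ∑ y ∈ box d N \ box d 0, jnorm y ^ (-s) := by
          rw [← box_erase_zero_eq_sdiff, ← Finset.add_sum_erase _ _ (zero_mem_box d N), jnorm_zero, Real.one_rpow]
      _ ≤ 1 + C₀ * ((0 : ℕ) + 1 : ℝ) ^ ((d : ℝ) - s) := by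
          have := htail 0 N
          push_cast at this ⊢
          linarith
      _ = 1 + C₀ := by simp
      _ ≤ (1 + C₀) * (d : ℝ) ^ ((s - d) / 2) := by
          have h1 : (1 : ℝ) ≤ (d : ℝ) ^ ((s - d) / 2) := Real.one_le_rpow (by exact_mod_cast hd) (by linarith)
          nlinarith
  · -- large radius: the region lies outside `Λ_M`, `M = ⌊R/√d⌋`
    set M := ⌊R / √(d : ℝ)⌋₊ with hM
    have hsq : (0 : ℝ) < √(d : ℝ) := Real.sqrt_pos.2 hd0
    have hRpos : 0 < R := by linarith
    calc ∑ y ∈ u, {y : Site d | euclidNorm y ≤ R}ᶜ.indicator (fun y => jnorm y ^ (-s)) y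
        = ∑ y ∈ u with R < euclidNorm y, jnorm y ^ (-s) := by
          rw [Finset.sum_filter]
          refine Finset.sum_congr rfl fun y _ => ?_
          by_cases h : R < euclidNorm y
          · rw [if_pos h, Set.indicator_of_mem (by simpa using h)]
          · rw [if_neg h, Set.indicator_of_notMem (by simpa using h)]
      _ ≤ ∑ y ∈ box d N \ box d M, jnorm y ^ (-s) := by
          refine Finset.sum_le_sum_of_subset_of_nonneg (fun y hy => ?_) fun y _ _ => Real.rpow_nonneg (jnorm_pos y).le _
          rw [Finset.mem_filter] at hy
          exact Finset.mem_sdiff.2 ⟨huN hy.1, not_mem_box_of_lt_euclidNorm hd hRpos.le hy.2⟩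
      _ ≤ C₀ * ((M : ℝ) + 1) ^ ((d : ℝ) - s) := htail M N
      _ ≤ C₀ * (R / √(d : ℝ)) ^ ((d : ℝ) - s) := by
          refine mul_le_mul_of_nonneg_left ?_ htc
          have hds : (d : ℝ) - s ≤ 0 := by linarith
          exact Real.rpow_le_rpow_of_nonpos (div_pos hRpos hsq) (Nat.lt_floor_add_one _).le hds
      _ = C₀ * (d : ℝ) ^ ((s - d) / 2) * R ^ ((d : ℝ) - s) := by
          rw [Real.div_rpow hRpos.le hsq.le, Real.sqrt_eq_rpow, ← Real.rpow_mul hd0.le]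
          rw [div_eq_mul_inv, ← Real.rpow_neg hd0.le]
          ring_nf
      _ ≤ (1 + C₀) * (d : ℝ) ^ ((s - d) / 2) * (max R 1) ^ ((d : ℝ) - s) := by
          rw [max_eq_left hR1]
          have h1 : 0 ≤ (d : ℝ) ^ ((s - d) / 2) * R ^ ((d : ℝ) - s) := by positivity
          nlinarith


/-! ### Euclidean geometry of lattice points -/

/-- `|x - y| = |y - x|`. [folklore] -/
theorem euclidNorm_sub_rev (x y : Site d) : euclidNorm (x - y) = euclidNorm (y - x) := by
  rw [← euclidNorm_neg, neg_sub]

/-- `|x| ≤ |x - y| + |y|`. [folklore] -/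
theorem euclidNorm_le_sub_add (x y : Site d) : euclidNorm x ≤ euclidNorm (x - y) + euclidNorm y := by
  simpa using euclidNorm_add_le (x - y) y

/-- `|x| ≤ |x + y| + |y|`. [folklore] -/
theorem euclidNorm_le_add_add (x y : Site d) : euclidNorm x ≤ euclidNorm (x + y) + euclidNorm y := by
  simpa [euclidNorm_neg] using euclidNorm_add_le (x + y) (-y)

/-- `| |x - y| - |x| | ≤ |y|`. [folklore] -/
theorem abs_euclidNorm_sub_sub_le (x y : Site d) : |euclidNorm (x - y) - euclidNorm x| ≤ euclidNorm y := by
  rw [abs_le]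
  constructor
  · linarith [euclidNorm_le_sub_add x y]
  · have := euclidNorm_add_le x (-y)
    rw [← sub_eq_add_neg, euclidNorm_neg] at this
    linarith

/-- `| |x + y| - |x| | ≤ |y|`. [folklore] -/
theorem abs_euclidNorm_add_sub_le (x y : Site d) : |euclidNorm (x + y) - euclidNorm x| ≤ euclidNorm y := by
  simpa [euclidNorm_neg] using abs_euclidNorm_sub_sub_le x (-y)

/-- `2|x| ≤ |x - y| + |x + y|`. [folklore] -/
theorem two_mul_euclidNorm_le (x y : Site d) : 2 * euclidNorm x ≤ euclidNorm (x - y) + euclidNorm (x + y) := by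
  have h := euclidNorm_add_le (x - y) (x + y)
  have e : x - y + (x + y) = x + x := by abel
  rw [e] at h
  have h2 : euclidNorm (x + x) = 2 * euclidNorm x := by
    unfold euclidNorm
    rw [show (2 : ℝ) = √(2 ^ 2) by rw [Real.sqrt_sq (by norm_num)], ← Real.sqrt_mul (by norm_num), Finset.mul_sum]
    congr 1
    refine Finset.sum_congr rfl fun i _ => ?_
    simp only [Pi.add_apply, Int.cast_add]
    ring
  linarith

/-- The parallelogram law `|x - y|² + |x + y|² = 2|x|² + 2|y|²`. [folklore] -/
theorem euclidNorm_sub_sq_add_euclidNorm_add_sq (x y : Site d) :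
    euclidNorm (x - y) ^ 2 + euclidNorm (x + y) ^ 2 = 2 * euclidNorm x ^ 2 + 2 * euclidNorm y ^ 2 := by
  simp only [euclidNorm_sq, Pi.sub_apply, Pi.add_apply, Int.cast_sub, Int.cast_add, Finset.mul_sum,
    ← Finset.sum_add_distrib]
  exact Finset.sum_congr rfl fun i _ => by ring

/-- `⟦x⟧ ≤ c ⟦y⟧` as soon as `|x| ≤ c|y|` and `c ≥ 1`. [folklore] -/
theorem jnorm_le_mul_jnorm {x y : Site d} {c : ℝ} (hc : 1 ≤ c) (h : euclidNorm x ≤ c * euclidNorm y) :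
    jnorm x ≤ c * jnorm y := by
  have h1 := one_le_jnorm y
  have h2 := euclidNorm_le_jnorm y
  unfold jnorm at *
  refine max_le ?_ ?_
  · exact h.trans (by gcongr)
  · nlinarith

/-- `⟦y⟧^{-s} ≤ c^s ⟦x⟧^{-s}` when `⟦x⟧ ≤ c⟦y⟧`, `c > 0`, `s ≥ 0`. [folklore] -/
theorem jnorm_rpow_neg_le_of_jnorm_le {x y : Site d} {c s : ℝ} (hc : 0 < c) (hs : 0 ≤ s)
    (h : jnorm x ≤ c * jnorm y) : jnorm y ^ (-s) ≤ c ^ s * jnorm x ^ (-s) := by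
  have hy := jnorm_pos y
  have hx := jnorm_pos x
  have h1 : jnorm x / c ≤ jnorm y := by rw [div_le_iff₀ hc]; linarith
  calc jnorm y ^ (-s) ≤ (jnorm x / c) ^ (-s) := Real.rpow_le_rpow_of_nonpos (div_pos hx hc) h1 (by linarith)
    _ = c ^ s * jnorm x ^ (-s) := by
        rw [Real.div_rpow hx.le hc.le, Real.rpow_neg hc.le, div_inv_eq_mul, mul_comm]

/-- `(|x|/c ∨ 1) ≤ ⟦x⟧` for `c ≥ 1`. [folklore] -/
theorem max_div_one_le_jnorm (x : Site d) {c : ℝ} (hc : 1 ≤ c) : max (euclidNorm x / c) 1 ≤ jnorm x := by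
  refine max_le ?_ (one_le_jnorm x)
  have h := euclidNorm_le_jnorm x
  have h0 := euclidNorm_nonneg x
  rw [div_le_iff₀ (by linarith)]
  nlinarith [one_le_jnorm x]

/-- `⟦x⟧ ≤ c (|x|/c ∨ 1)` for `c > 0`... stated for `c ≥ 1`. [folklore] -/
theorem jnorm_le_mul_max_div_one (x : Site d) {c : ℝ} (hc : 1 ≤ c) : jnorm x ≤ c * max (euclidNorm x / c) 1 := by
  unfold jnorm
  refine max_le ?_ ?_
  · calc euclidNorm x = c * (euclidNorm x / c) := by field_simp
      _ ≤ c * max (euclidNorm x / c) 1 := by gcongr; exact le_max_left _ _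
  · calc (1 : ℝ) ≤ c * 1 := by linarith
      _ ≤ c * max (euclidNorm x / c) 1 := by gcongr; exact le_max_right _ _

/-- `(|x|/c ∨ 1)^e ≤ ⟦x⟧^e` for `e ≥ 0`, `c ≥ 1`. [folklore] -/
theorem max_div_one_rpow_le (x : Site d) {c e : ℝ} (hc : 1 ≤ c) (he : 0 ≤ e) :
    (max (euclidNorm x / c) 1) ^ e ≤ jnorm x ^ e :=
  Real.rpow_le_rpow (zero_le_one.trans (le_max_right _ _)) (max_div_one_le_jnorm x hc) he

/-- `(|x|/c ∨ 1)^{-s} ≤ c^s ⟦x⟧^{-s}` for `s ≥ 0`, `c ≥ 1`. [folklore] -/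
theorem max_div_one_rpow_neg_le (x : Site d) {c s : ℝ} (hc : 1 ≤ c) (hs : 0 ≤ s) :
    (max (euclidNorm x / c) 1) ^ (-s) ≤ c ^ s * jnorm x ^ (-s) := by
  have hm : 0 < max (euclidNorm x / c) 1 := lt_of_lt_of_le one_pos (le_max_right _ _)
  have hx := jnorm_pos x
  have hc0 : 0 < c := by linarith
  have h1 : jnorm x / c ≤ max (euclidNorm x / c) 1 := by
    rw [div_le_iff₀ hc0, mul_comm]; exact jnorm_le_mul_max_div_one x hc
  calc (max (euclidNorm x / c) 1) ^ (-s) ≤ (jnorm x / c) ^ (-s) :=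
        Real.rpow_le_rpow_of_nonpos (div_pos hx hc0) h1 (by linarith)
    _ = c ^ s * jnorm x ^ (-s) := by
        rw [Real.div_rpow hx.le hc0.le, Real.rpow_neg hc0.le, div_inv_eq_mul, mul_comm]

/-- `C/⟦x⟧^s = C ⟦x⟧^{-s}`. [folklore] -/
theorem div_jnorm_rpow_eq (C : ℝ) (x : Site d) (s : ℝ) : C / jnorm x ^ s = C * jnorm x ^ (-s) := by
  rw [Real.rpow_neg (jnorm_pos x).le, div_eq_mul_inv]

/-- `⟦x⟧^a ⟦x⟧^b = ⟦x⟧^{a+b}`. [folklore] -/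
theorem jnorm_rpow_mul_rpow (x : Site d) (a b : ℝ) : jnorm x ^ a * jnorm x ^ b = jnorm x ^ (a + b) :=
  (Real.rpow_add (jnorm_pos x) a b).symm

/-- Monotonicity in the exponent: `⟦x⟧^a ≤ ⟦x⟧^b` for `a ≤ b`. [folklore] -/
theorem jnorm_rpow_le_rpow_of_le (x : Site d) {a b : ℝ} (h : a ≤ b) : jnorm x ^ a ≤ jnorm x ^ b :=
  Real.rpow_le_rpow_of_exponent_le (one_le_jnorm x) h

/-- `|y|^2 ⟦y⟧^{-s} ≤ ⟦y⟧^{2-s}`. [folklore] -/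
theorem euclidNorm_sq_mul_jnorm_rpow_neg_le (y : Site d) (s : ℝ) :
    euclidNorm y ^ 2 * jnorm y ^ (-s) ≤ jnorm y ^ (2 - s) := by
  have h := euclidNorm_rpow_le_jnorm_rpow y (a := 2) (by norm_num)
  rw [show ((2 : ℝ)) = ((2 : ℕ) : ℝ) by norm_num, Real.rpow_natCast, Real.rpow_natCast] at h
  calc euclidNorm y ^ 2 * jnorm y ^ (-s) ≤ jnorm y ^ 2 * jnorm y ^ (-s) := by
        gcongr
        exact Real.rpow_nonneg (jnorm_pos y).le _
    _ = jnorm y ^ (2 - s) := by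
        rw [← Real.rpow_natCast, jnorm_rpow_mul_rpow]; norm_num; ring_nf


/-! ### Region-restricted lattice sums -/

/-- Splitting a lattice sum along a region and its complement. [folklore] -/
theorem tsum_eq_tsum_indicator_add_compl {F : Site d → ℝ} (hF : Summable F) (s : Set (Site d)) :
    ∑' y, F y = ∑' y, s.indicator F y + ∑' y, sᶜ.indicator F y := by
  rw [← Summable.tsum_add (hF.indicator s) (hF.indicator sᶜ)]
  exact tsum_congr fun y => (congrFun (Set.indicator_self_add_compl s F) y).symm

/-- Bounding a region-restricted sum termwise. [folklore] -/
theorem abs_tsum_indicator_le {F G : Site d → ℝ} {s : Set (Site d)} (hF : Summable F)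
    (hG : Summable (s.indicator G)) (h : ∀ y ∈ s, |F y| ≤ G y) :
    |∑' y, s.indicator F y| ≤ ∑' y, s.indicator G y := by
  have h1 : Summable fun y => ‖s.indicator F y‖ := (hF.indicator s).norm
  refine (Real.norm_eq_abs _ ▸ norm_tsum_le_tsum_norm h1).trans ?_
  refine Summable.tsum_le_tsum (fun y => ?_) h1 hG
  by_cases hy : y ∈ s
  · rw [Set.indicator_of_mem hy, Set.indicator_of_mem hy, Real.norm_eq_abs]; exact h y hy
  · rw [Set.indicator_of_notMem hy, Set.indicator_of_notMem hy, norm_zero]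

/-- Bounding a full lattice sum termwise. [folklore] -/
theorem abs_tsum_le_tsum_of_le {F G : Site d → ℝ} (hF : Summable F) (hG : Summable G) (h : ∀ y, |F y| ≤ G y) :
    |∑' y, F y| ≤ ∑' y, G y := by
  have h1 : Summable fun y => ‖F y‖ := hF.norm
  refine (Real.norm_eq_abs _ ▸ norm_tsum_le_tsum_norm h1).trans ?_
  exact Summable.tsum_le_tsum (fun y => (Real.norm_eq_abs _).le.trans (h y)) h1 hG

/-- The constant in a decay hypothesis `|f y| ≤ A ⟦y⟧^{-a}` is nonnegative. [folklore] -/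
theorem nonneg_of_decay {f : Site d → ℝ} {A a : ℝ} (hf : ∀ y, |f y| ≤ A * jnorm y ^ (-a)) : 0 ≤ A := by
  simpa using (abs_nonneg _).trans (hf 0)

/-- `⟦z⟧^{-n} = (⟦z⟧^n)⁻¹` for a natural exponent. [folklore] -/
theorem jnorm_rpow_neg_natCast (z : Site d) (n : ℕ) : jnorm z ^ (-(n : ℝ)) = (jnorm z ^ n)⁻¹ := by
  rw [Real.rpow_neg (jnorm_pos z).le, Real.rpow_natCast]


end Literature.Barriers.CriticalPhenomena
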